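import Summits.HodgeConjecture.HodgeConjecture.Theses.MotivatedLefschetzSplit

/-!
# Crux `LefschetzStandardB` (stmt-HodgeConjecture-17489) — birth skeleton `Lines/birth.lean`

Route `HodgeConjecture/MotivatedLefschetzSplit`, crux #3 (rank 3):
`LefschetzStandardB := ∀ d Z η, IsSmoothProjective d Z → StandardConjectureBStar d Z η` —
Grothendieck's standard conjecture of Lefschetz type for EVERY smooth projective complex variety,
in André's form: for every polarisation class `η` of the `d`-fold `Z` and all `a + b = 2d` the
Lefschetz involution `*_L : Hᵃ(Z(ℂ); ℂ) → Hᵇ(Z(ℂ); ℂ)` is induced by an algebraic class on `Z × Z`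
(`IsAlgebraicCorrespondence d d Z Z (lefschetzInvolution …)`).

## The line (degree dichotomy + Charles's spread criterion + Kleiman's Cayley–Hamilton transfer)

`*_L` on `Hᵃ` is `L^{d-a}` for `a ≤ d` (a THEOREM: cup product with the algebraic class `η^{d-a}`,
induced by `Δ_* η^{d-a}`) and the INVERSE of `L^{a-d} : Hᵇ → Hᵃ` for `a > d` (the content of `B`).
For the upper half we do not ask for the inverse itself but, following Kleiman (1994, Thm. 4-1) and
Charles (2013 = arXiv:1002.5011, Lemma 6 and Prop. 8), for a SUPPLY statement:

* `stub_lowerHalf` (theorem-grade, size M): `a ≤ d ⇒ *_L = L^{d-a}` is an algebraic correspondence.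
  In tree already: the degrees `a = d` (`standardConjectureBStar_of_eq_middle`), `a + 1 = d`
  (`standardConjectureBStar_of_succ_eq`) and the engine `isAlgebraicCorrespondence_cupProduct_right`
  (`(· ∪ γ₀) = [Δ_* γ₀]^*`, file `Theorems/HeckePrymWeilSummitOffWeilSectorLefschetzBInstances`);
  missing: `η^j ∈ Nʲ H²ʲ` for a divisor-supported `η` (cup powers of divisor classes; conditional
  forms `cupProduct_mem_algebraicClasses_one_of_forall_primeDivisor`, `…_of_moving_right`).
* `stub_familySupply` (THE CRUX CONTENT, open from `d = 3`, `b = 2` on): for every smooth projective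
  `Z` of dimension `d` and every degree `b < d` (`a + b = 2d`, `d < a`) there are a smooth projective
  `S` of some dimension `l ≥ b` and a SURJECTIVE algebraic correspondence
  `T = [Γ]_* : H^{2l-b}(S(ℂ); ℂ) → Hᵇ(Z(ℂ); ℂ)` (`Γ` of codimension `b` on `Z × S`): "`Hᵇ(Z)` is swept
  out by a family of codimension-`b` algebraic cycles on `Z` parametrised by `S`" — the right-hand
  side of Charles 2013 Prop. 8; for `b = 2` it is his Thm. 1 (`φ_{Z,s} : Λ² T_{S,s} ↠ H²(Z, 𝒪_Z)`),
  for hyperkähler `Z` his Thm. 3 (non-rigid stable hyperholomorphic bundles), for `b = 1` the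
  Picard family. Implied by `B` (take `S = Z`, `T = *_L`), hence by `HC(Z × Z)` — not more false
  than the summit.
* `stub_charlesSpread` (theorem in print, size L): Charles 2013 Prop. 8, direction ⇐, on the real
  carriers — given, for ALL smooth projective varieties, the lower half (what `L^{l-b}` on the
  parameter variety needs) and `B` in all target degrees `b' ≤ b - 2` (what his Lemma 7 consumes on
  `S`; the strong induction of the assembly supplies both) and a family
  supply for `(Z, b)`, there is a BIJECTIVE algebraic self-correspondence `θ : Hᵃ(Z) → Hᵇ(Z)`
  (`θ = [Γ]_* ∘ L^{l-b} ∘ s ∘ [Γ]^t`, Hodge index theorem on `Hᵇ(S)`; `ℚ`-structure: a surjective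
  `ℂ`-combination `Σ cᵢ [Γᵢ]_*` is first replaced by the surjective CYCLE correspondence
  `Σ prᵢ^* Γᵢ` from `S^r`, which is why the hypothesis is `B` below `b` for all varieties, not just `S`).
* `stub_cayleyHamiltonTransfer` (theorem in print, size M): Kleiman 1994 Thm. 4-1 = Charles 2013
  Lemma 6 = André 1996 §3.2 Remarque: if `*_L : Hᵇ → Hᵃ` is algebraic (the Lefschetz-isomorphism
  direction) and SOME bijective algebraic `θ : Hᵃ → Hᵇ` exists, then `*_L : Hᵃ → Hᵇ` is algebraic:
  `u := θ ∘ *_L ∈ End Hᵇ` is algebraic and bijective, `u⁻¹ = P(u)` (Cayley–Hamilton, Mathlib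
  `LinearMap.aeval_self_charpoly`), and `*_L⁽ᵃ→ᵇ⁾ = u⁻¹ ∘ θ` (`*_L ∘ *_L = id`,
  `lefschetzInvolution_lefschetzInvolution_of_le/_of_ge`). Needs: algebraic self-correspondences on
  the real carriers are closed under composition (`CorrespondenceComposition.corr_comp_of_baseChange`),
  `ℂ`-linear combinations, and contain `𝟙 = [Δ]^*` (`isAlgebraicCorrespondence_map`).

`LefschetzStandardB_of : Sig.stub_lowerHalf → Sig.stub_familySupply → Sig.stub_charlesSpread →
Sig.stub_cayleyHamiltonTransfer → LefschetzStandardB` (kernel-checked, no sorry; `Sig.stub_*` = the stub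
statements verbatim, named after the stubs for the A12 audit; `LefschetzStandardB_of_stubs :
LefschetzStandardB` instantiates it with the sorried stubs): degree dichotomy `a ≤ d ∨ d < a`; the upper half
by STRONG INDUCTION on the target degree `b` — at stage `b` the hypothesis of `stub_charlesSpread`
("`B` below `b` for all varieties") is the lower half (`stub_lowerHalf`) or the induction hypothesis.

Hardest stub: `stub_familySupply` (it is `B` proper in Charles's geometric form; first battleground
`d = 3`, `b = 2`: threefolds with `h^{2,0} ≠ 0`, Charles 2013 Thm. 1–2). Disproof used: none (no
`Disproof.lean` on this crux yet; `ledger negatives --problem HodgeConjecture`: no entry touches `B`).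
Crux ideas on file to feed `stub_familySupply`: `niveau-sweep-diagonal` (Vial's sweep criterion),
`one-detector-per-block` (Charles Prop. 8 for `k = 2` + Hodge-irreducibility block lemma).

References: [Kleiman1968AlgebraicCycles] §2; S. Kleiman, *The standard conjectures*, Motives (1994)
Thm. 4-1; [Charles2013] = arXiv:1002.5011, Lemma 6, Lemma 7, Prop. 8, Cor. 10, Thm. 1–3;
[Andre1996Motifs] §1.1, §3.2 Remarque; [Lieberman1968]; [VoisinHodgeII2003] Prop. 9.20–9.21, (10.7).
-/

-- every declaration of this problem lives in `Summit.HodgeConjecture.HodgeConjecture.…` (summit = sub-problem)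
set_option linter.dupNamespace false

namespace Summit.HodgeConjecture.HodgeConjecture.Cruxes.LefschetzStandardB.Birth

open Literature.AlgebraicGeometry.Motives Literature.AlgebraicGeometry.HodgeTheory

/-! ### The stub statements as named propositions

`Sig.stub_<name>` is the statement of `stub_<name>` VERBATIM (an `abbrev`, so definitionally the same
term); they exist only so that the skeleton theorem `LefschetzStandardB_of` takes its four hypotheses BY
THE STUBS' NAMES (the A12 skeleton audit admits a `Prop` hypothesis only when its head constant is a
registered obligation or a declared stub, by name). -/

namespace Sig

/-- The statement of `stub_lowerHalf`, verbatim. -/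
abbrev stub_lowerHalf : Prop :=
    ∀ (d : ℕ) (Z : SchemeOver ℂ) (η : complexBetti Z 2), IsSmoothProjective d Z →
      ∀ (hη : IsPolarizationClass d Z η) (a b : ℕ) (hab : a + b = 2 * d), a ≤ d →
        IsAlgebraicCorrespondence d d Z Z (lefschetzInvolution hη.hasHardLefschetz hab)

/-- The statement of `stub_familySupply`, verbatim. -/
abbrev stub_familySupply : Prop :=
    ∀ (d : ℕ) (Z : SchemeOver ℂ), IsSmoothProjective d Z →
      ∀ (a b : ℕ), a + b = 2 * d → d < a →
        ∃ (l : ℕ) (S : SchemeOver ℂ) (_ : IsSmoothProjective l S) (a' : ℕ) (_ : a' + b = 2 * l)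
          (_ : b ≤ l) (T : complexBetti S a' →ₗ[ℂ] complexBetti Z b),
          Function.Surjective T ∧ IsAlgebraicCorrespondence d l Z S T

/-- The statement of `stub_charlesSpread`, verbatim. -/
abbrev stub_charlesSpread : Prop :=
    ∀ (d : ℕ) (Z : SchemeOver ℂ), IsSmoothProjective d Z →
      ∀ (a b : ℕ), a + b = 2 * d → d < a →
        (∀ (l : ℕ) (S : SchemeOver ℂ) (κ : complexBetti S 2), IsSmoothProjective l S →
          ∀ (hκ : IsPolarizationClass l S κ) (a' b' : ℕ) (hab' : a' + b' = 2 * l),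
            a' ≤ l ∨ b' + 2 ≤ b →
            IsAlgebraicCorrespondence l l S S (lefschetzInvolution hκ.hasHardLefschetz hab')) →
        (∃ (l : ℕ) (S : SchemeOver ℂ) (_ : IsSmoothProjective l S) (a' : ℕ) (_ : a' + b = 2 * l)
          (_ : b ≤ l) (T : complexBetti S a' →ₗ[ℂ] complexBetti Z b),
          Function.Surjective T ∧ IsAlgebraicCorrespondence d l Z S T) →
        ∃ θ : complexBetti Z a →ₗ[ℂ] complexBetti Z b,
          Function.Bijective θ ∧ IsAlgebraicCorrespondence d d Z Z θ

/-- The statement of `stub_cayleyHamiltonTransfer`, verbatim. -/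
abbrev stub_cayleyHamiltonTransfer : Prop :=
    ∀ (d : ℕ) (Z : SchemeOver ℂ) (η : complexBetti Z 2), IsSmoothProjective d Z →
      ∀ (hη : IsPolarizationClass d Z η) (a b : ℕ) (hab : a + b = 2 * d) (hba : b + a = 2 * d),
        IsAlgebraicCorrespondence d d Z Z (lefschetzInvolution hη.hasHardLefschetz hba) →
        (∃ θ : complexBetti Z a →ₗ[ℂ] complexBetti Z b,
            Function.Bijective θ ∧ IsAlgebraicCorrespondence d d Z Z θ) →
          IsAlgebraicCorrespondence d d Z Z (lefschetzInvolution hη.hasHardLefschetz hab)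

end Sig

/-- **Stub 1 — the lower half of `B` (theorem-grade).** For `Z` smooth projective of dimension `d`,
a polarisation class `η` and `a + b = 2d` with `a ≤ d`, the Lefschetz involution
`*_L = L^{d-a} : Hᵃ(Z(ℂ); ℂ) → Hᵇ(Z(ℂ); ℂ)` (`lefschetzInvolution_apply_of_le`) is induced by an
algebraic correspondence: `L^{d-a} = (· ∪ η^{d-a})` up to graded commutativity, `η^{d-a} ∈ N^{d-a}`
(cup powers of the divisor-supported class `η`), and `(· ∪ γ₀) = [Δ_* γ₀]^*`
(`isAlgebraicCorrespondence_cupProduct_right`). [cite: Andre1996Motifs, §1.1 (p. 10)]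
[cite: Kleiman1968AlgebraicCycles, §2] -/
theorem stub_lowerHalf :
    ∀ (d : ℕ) (Z : SchemeOver ℂ) (η : complexBetti Z 2), IsSmoothProjective d Z →
      ∀ (hη : IsPolarizationClass d Z η) (a b : ℕ) (hab : a + b = 2 * d), a ≤ d →
        IsAlgebraicCorrespondence d d Z Z (lefschetzInvolution hη.hasHardLefschetz hab) := by
  sorry

/-- **Stub 2 — family supply above the middle (the crux content; Charles 2013 Prop. 8, right-hand
side).** For `Z` smooth projective of dimension `d` and degrees `a + b = 2d` with `d < a` (so
`b < d`), the cohomology `Hᵇ(Z(ℂ); ℂ)` is swept out by a family of codimension-`b` algebraic cycles: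
there are a smooth projective `S` of dimension `l ≥ b` and a SURJECTIVE algebraic correspondence
`T = [Γ]_* : H^{2l-b}(S(ℂ); ℂ) → Hᵇ(Z(ℂ); ℂ)`, `Γ ∈ Nᵇ H²ᵇ((Z ⊗ S)(ℂ))`
(`IsAlgebraicCorrespondence d l Z S T`). Implied by `B(Z)` (`S = Z`, `T = *_L`); for `b = 2`
Charles's Thm. 1 (`φ_{Γ,s} : Λ² T_{S,s} ↠ H²(Z, 𝒪_Z)`); open in general from `d = 3`, `b = 2`.
[cite: Charles2013, Prop. 8 and Thm. 1 (arXiv:1002.5011)] -/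
theorem stub_familySupply :
    ∀ (d : ℕ) (Z : SchemeOver ℂ), IsSmoothProjective d Z →
      ∀ (a b : ℕ), a + b = 2 * d → d < a →
        ∃ (l : ℕ) (S : SchemeOver ℂ) (_ : IsSmoothProjective l S) (a' : ℕ) (_ : a' + b = 2 * l)
          (_ : b ≤ l) (T : complexBetti S a' →ₗ[ℂ] complexBetti Z b),
          Function.Surjective T ∧ IsAlgebraicCorrespondence d l Z S T := by
  sorry

/-- **Stub 3 — Charles's spread criterion (Charles 2013 Prop. 8, direction ⇐; theorem in print).**
For `Z` smooth projective of dimension `d` and `a + b = 2d`, `d < a`: if, for ALL smooth projective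
complex varieties `S` and all polarisation classes, the Lefschetz involution is an algebraic
correspondence in the lower half `a' ≤ dim S` (theorem-grade, stub 1: `L^{l-b}` on the parameter
variety) and in every target degree `b' ≤ b - 2` (conjecture `B` below `b`, consumed by Charles's
Lemma 7: the projections onto the Lefschetz components of `Hᵇ(S)`, hence the sign operator `s`, are
algebraic), and `Hᵇ(Z)` has a family supply (stub 2's conclusion), then there is a BIJECTIVE
algebraic self-correspondence `θ : Hᵃ(Z(ℂ); ℂ) → Hᵇ(Z(ℂ); ℂ)`, namely
`θ = [Γ]_* ∘ L^{l-b} ∘ s ∘ [Γ]^t` for an ample polarisation of `S` (transpose and composition of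
algebraic correspondences; injectivity by the Hodge index theorem on the sub-Hodge structure
`[Γ]^t Hᵃ(Z, ℚ) ⊆ Hᵇ(S, ℚ)`, `dim Hᵃ(Z) = dim Hᵇ(Z)` by Poincaré duality; a surjective
`ℂ`-combination `Σ cᵢ [Γᵢ]_*` of cycle correspondences is first replaced by the surjective cycle
correspondence `Σ prᵢ^* Γᵢ` from `S^r`, to which the all-varieties hypothesis still applies).
[cite: Charles2013, Prop. 8 with Lemma 7 (arXiv:1002.5011)] -/
theorem stub_charlesSpread :
    ∀ (d : ℕ) (Z : SchemeOver ℂ), IsSmoothProjective d Z →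
      ∀ (a b : ℕ), a + b = 2 * d → d < a →
        (∀ (l : ℕ) (S : SchemeOver ℂ) (κ : complexBetti S 2), IsSmoothProjective l S →
          ∀ (hκ : IsPolarizationClass l S κ) (a' b' : ℕ) (hab' : a' + b' = 2 * l),
            a' ≤ l ∨ b' + 2 ≤ b →
            IsAlgebraicCorrespondence l l S S (lefschetzInvolution hκ.hasHardLefschetz hab')) →
        (∃ (l : ℕ) (S : SchemeOver ℂ) (_ : IsSmoothProjective l S) (a' : ℕ) (_ : a' + b = 2 * l)
          (_ : b ≤ l) (T : complexBetti S a' →ₗ[ℂ] complexBetti Z b),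
          Function.Surjective T ∧ IsAlgebraicCorrespondence d l Z S T) →
        ∃ θ : complexBetti Z a →ₗ[ℂ] complexBetti Z b,
          Function.Bijective θ ∧ IsAlgebraicCorrespondence d d Z Z θ := by
  sorry

/-- **Stub 4 — Kleiman's Cayley–Hamilton transfer (Kleiman 1994 Thm. 4-1; Charles 2013 Lemma 6;
André 1996 §3.2 Remarque; theorem in print).** For `Z` smooth projective of dimension `d`, a
polarisation class `η` and `a + b = 2d`: if the Lefschetz involution `*_L : Hᵇ → Hᵃ` is an algebraic
correspondence and SOME bijective algebraic correspondence `θ : Hᵃ → Hᵇ` exists, then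
`*_L : Hᵃ → Hᵇ` is an algebraic correspondence — `u := θ ∘ *_L⁽ᵇ→ᵃ⁾ ∈ End Hᵇ` is algebraic and
bijective, `u⁻¹ = P(u)` by Cayley–Hamilton, and `*_L⁽ᵃ→ᵇ⁾ = u⁻¹ ∘ θ` since `*_L ∘ *_L = 𝟙`
(`lefschetzInvolution_lefschetzInvolution_of_le/_of_ge`); uses that algebraic self-correspondences
are closed under composition and `ℂ`-linear combinations and contain `𝟙 = [Δ]^*`.
[cite: Charles2013, Lemma 6 (arXiv:1002.5011)] [cite: Andre1996Motifs, §3.2 Remarque (p. 21)]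
[cite: Kleiman1968AlgebraicCycles, §2] -/
theorem stub_cayleyHamiltonTransfer :
    ∀ (d : ℕ) (Z : SchemeOver ℂ) (η : complexBetti Z 2), IsSmoothProjective d Z →
      ∀ (hη : IsPolarizationClass d Z η) (a b : ℕ) (hab : a + b = 2 * d) (hba : b + a = 2 * d),
        IsAlgebraicCorrespondence d d Z Z (lefschetzInvolution hη.hasHardLefschetz hba) →
        (∃ θ : complexBetti Z a →ₗ[ℂ] complexBetti Z b,
            Function.Bijective θ ∧ IsAlgebraicCorrespondence d d Z Z θ) →
          IsAlgebraicCorrespondence d d Z Z (lefschetzInvolution hη.hasHardLefschetz hab) := by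
  sorry

/-- **Assembly (kernel-checked, no `sorry`): the four stub STATEMENTS (`Sig.stub_*`, verbatim) imply the
crux `LefschetzStandardB` by name.**
Degree dichotomy: `a ≤ d` is stub 1; for `d < a` a STRONG INDUCTION on the target degree `b` —
stub 4 reduces `*_L : Hᵃ → Hᵇ` to the lower-half instance `*_L : Hᵇ → Hᵃ` (stub 1) and a bijective
algebraic `θ : Hᵃ → Hᵇ`, which stub 3 produces from the family supply of stub 2 and `B` in target
degrees `≤ b - 2` for all varieties (stub 1 below the middle, the induction hypothesis above it).
[cite: Charles2013, Lemma 6 and Prop. 8 (arXiv:1002.5011)] -/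
theorem LefschetzStandardB_of :
    Sig.stub_lowerHalf → Sig.stub_familySupply → Sig.stub_charlesSpread →
      Sig.stub_cayleyHamiltonTransfer →
        Summit.HodgeConjecture.HodgeConjecture.Theses.MotivatedLefschetzSplit.LefschetzStandardB := by
  intro h₁ h₂ h₃ h₄
  -- the upper half `d < a`, by strong induction on the target degree `b`
  have upper : ∀ (b d : ℕ) (Z : SchemeOver ℂ) (η : complexBetti Z 2), IsSmoothProjective d Z →
      ∀ (hη : IsPolarizationClass d Z η) (a : ℕ) (hab : a + b = 2 * d), d < a →
        IsAlgebraicCorrespondence d d Z Z (lefschetzInvolution hη.hasHardLefschetz hab) := by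
    intro b
    induction b using Nat.strong_induction_on with
    | _ b ih =>
      intro d Z η hZ hη a hab hda
      refine h₄ d Z η hZ hη a b hab (by omega) (h₁ d Z η hZ hη b a (by omega) (by omega)) ?_
      refine h₃ d Z hZ a b hab hda ?_ (h₂ d Z hZ a b hab hda)
      intro l S κ hS hκ a' b' hab' h
      rcases Nat.lt_or_ge l a' with h' | h'
      · have hb' : b' + 2 ≤ b := h.resolve_left (by omega)
        exact ih b' (by omega) l S κ hS hκ a' hab' h'
      · exact h₁ l S κ hS hκ a' b' hab' h'
  intro d Z η hZ hη a b hab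
  rcases Nat.lt_or_ge d a with ha | ha
  · exact upper b d Z η hZ hη a hab ha
  · exact h₁ d Z η hZ hη a b hab ha

/-- **Registered target of the skeleton — the crux BY NAME with NO hypotheses**: `LefschetzStandardB_of`
instantiated with the four declared stubs. NOT a proof of the crux: its axioms contain `sorryAx`, exactly
through `stub_lowerHalf`, `stub_familySupply`, `stub_charlesSpread`, `stub_cayleyHamiltonTransfer` (the
only declarations of this file that use `sorry`). -/
theorem LefschetzStandardB_of_stubs :
    Summit.HodgeConjecture.HodgeConjecture.Theses.MotivatedLefschetzSplit.LefschetzStandardB :=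
  LefschetzStandardB_of stub_lowerHalf stub_familySupply stub_charlesSpread stub_cayleyHamiltonTransfer

end Summit.HodgeConjecture.HodgeConjecture.Cruxes.LefschetzStandardB.Birth
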